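import Summits.AtomisticToContinuum.HydrodynamicLimit.Theorems.ImplosionDichotomyPolynomialCompressionLevel3DefsB
import Summits.AtomisticToContinuum.HydrodynamicLimit.Theorems.ImplosionDichotomyPolynomialCompressionCloseStep
import Summits.AtomisticToContinuum.HydrodynamicLimit.Theorems.ImplosionDichotomyPolynomialCompressionClosePrep
import Summits.AtomisticToContinuum.HydrodynamicLimit.Theorems.ImplosionDichotomyPolynomialCompressionTorusJetCalculus
import Summits.AtomisticToContinuum.HydrodynamicLimit.Theorems.ImplosionDichotomyPolynomialCompressionPcInit

/-!
# Closing of stub 4: the improvement step of the continuous induction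

Helper file for the line `log-lipschitz-budget` of the crux `ImplosionDichotomy.PolynomialCompression`
(stmt-AtomisticToContinuum-12587), stub `stub_logBudgetShadowing`, the CLOSE. One step of the bootstrap: if the WEAK
bounds hold on `[0, t]` (`ShadowWeakBootstrap 1 η_s` and `√E_k ≤ 2σ³ Q_k X^{b_k}`, `k = 1, 2, 3`), then the STRONG bounds
hold at `t`: the level-0 contract gives `E₀`, the level-3 contract gives `E₃` (its sup-smallness and window inputs from
the Sobolev bounds `lbClose_sup_bounds` in unweighted form `pcClose_sup_small'` and the smallness of `σ`), the
interpolation `shadow_interpolation_levels` then improves `E₂` and `E₁` (the level constants solve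
`√3 W Q₀Q₂ ≤ Q₁²`, `2√3 W Q₁Q₃ ≤ Q₂²`), and `lbClose_step` improves the state and derivative bounds. The three
contracts enter as hypotheses specialised to the configuration (texts `hL0`, `hL3`, `hI`), so that this file does
not depend on their proofs.
-/

noncomputable section

namespace Summit.AtomisticToContinuum.HydrodynamicLimit.Theorems

open Set MeasureTheory Filter Topology
open Literature.MathematicalPhysics.KineticTheory Literature.Analysis.FunctionSpaces

/-- Monotonicity of the normalised level bound in the constant AND the exponent (base `T₁/(T₁ - s) ≥ 1` on
`[0, t₀]`, `σ ≥ 0`, `0 ≤ Q ≤ Q'`, `b ≤ b'`). [folklore] -/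
theorem shadowLevelBound_mono_exp :
    ∀ {E : ℝ → ℝ} {Q Q' b b' T₁ σ t₀ : ℝ}, ShadowLevelBound E Q b T₁ σ t₀ → 0 ≤ Q → Q ≤ Q' → b ≤ b' → 0 ≤ σ →
      (∀ s ∈ Icc 0 t₀, 1 ≤ T₁ / (T₁ - s)) → ShadowLevelBound E Q' b' T₁ σ t₀ := by
  intro E Q Q' b b' T₁ σ t₀ h hQ hQQ hbb hσ hbase s hs
  refine (h s hs).trans ?_
  have hX := hbase s hs
  have h1 : (T₁ / (T₁ - s)) ^ b ≤ (T₁ / (T₁ - s)) ^ b' := Real.rpow_le_rpow_of_exponent_le hX hbb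
  have h2 : 0 ≤ (T₁ / (T₁ - s)) ^ b := Real.rpow_nonneg (zero_le_one.trans hX) b
  have h3 : 0 ≤ σ ^ 3 * Q' := mul_nonneg (pow_nonneg hσ 3) (hQ.trans hQQ)
  exact mul_le_mul (mul_le_mul_of_nonneg_left hQQ (pow_nonneg hσ 3)) h1 h2 h3

/-- **The improvement step** (see the module docstring). All constants and their relations are hypotheses; the
Sobolev facts `hSup` (`lbClose_sup_bounds` with its constant `KS`) and `hStep` (`lbClose_step` with its constant
`KT`), the level-0 and level-3 contracts `hL0`, `hL3` and the interpolation `hI` enter specialised to the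
configuration. [folklore] -/
theorem pcClose_step :
    ∀ {K C cZ T₁ cl pl σ T' t ηs r R qe qs Q₀ b₀ Q₁ b₁ Q₂ b₂ Q₃ b₃ W₀ pw Qh QS bS N KS KT : ℝ}
      {Cpoly ppoly Cstat : ℕ → ℝ} {ρ θ ρ₁ θ₁ : ℝ → T3 → ℝ} {u u₁ : ℝ → T3 → V3} {ζ : ℝ → ℝ} {J : Set ℝ},
      ShadowSetting K C cZ T₁ cl pl Cpoly ppoly Cstat σ T' ρ θ ρ₁ θ₁ u u₁ ζ J → 0 < K → 0 ≤ cZ →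
      t ∈ Ico 0 T' → 0 < ηs → ηs ≤ 1 / (8 * (cZ + 1)) → cZ * ηs ≤ 1 / 8 →
      0 < r → r ≤ 1 → 1 ≤ R → 0 ≤ qe → qe ≤ qs →
      (∀ s ∈ Ico 0 T', 1 ≤ T₁ / (T₁ - s) ∧ ∀ x, r / (T₁ / (T₁ - s)) ^ qe ≤ ρ₁ s x ^ (1 / 3 : ℝ) ∧
        ρ₁ s x ^ (1 / 3 : ℝ) ≤ R * (T₁ / (T₁ - s)) ^ qe) →
      0 ≤ Q₀ → Q₀ ≤ Q₁ → Q₁ ≤ Q₂ → 0 ≤ Q₃ → 0 ≤ b₀ → b₀ ≤ b₁ → b₁ ≤ b₂ → b₂ ≤ b₃ → b₃ ≤ qs → 0 ≤ W₀ →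
      6 * qe ≤ pw → Real.sqrt 3 * W₀ * Q₀ * Q₂ ≤ Q₁ ^ 2 → 2 * Real.sqrt 3 * W₀ * Q₁ * Q₃ ≤ Q₂ ^ 2 →
      pw + b₀ + b₂ ≤ 2 * b₁ → pw + b₁ + b₃ ≤ 2 * b₂ → Q₀ + 2 * Q₁ + 2 * Q₂ + 2 * Q₃ ≤ Qh →
      max (4 * K / r) (max (3 / 2 * R ^ 3) (9 / 2 * R / K)) / min (K / (4 * R)) (min (r ^ 3 / 2) (r / (2 * K))) ≤ W₀ →
      0 < KS → 15 * Real.sqrt (KS * (min (K / (4 * R)) (min (r ^ 3 / 2) (r / (2 * K))))⁻¹ * 6) * Qh ≤ QS →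
      3 * qs ≤ bS →
      (∀ {s mA mρ mB ℰ : ℝ}, s ∈ Ico 0 T' → 0 < mA → 0 < mρ → 0 < mB →
        (∀ x, mA ≤ shadowWeightA ζ ρ θ s x) → (∀ x, mρ ≤ ρ s x) → (∀ x, mB ≤ shadowWeightB ρ θ s x) →
        shadowE0 ζ ρ θ u ρ₁ θ₁ u₁ s ≤ ℰ → shadowE1 ζ ρ θ u ρ₁ θ₁ u₁ s ≤ ℰ →
        shadowE2 ζ ρ θ u ρ₁ θ₁ u₁ s ≤ ℰ → shadowE3 ζ ρ θ u ρ₁ θ₁ u₁ s ≤ ℰ →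
        ∀ x, (ρ s x - ρ₁ s x) ^ 2 ≤ KS * mA⁻¹ * (6 * ℰ) ∧ ‖u s x - u₁ s x‖ ^ 2 ≤ KS * mρ⁻¹ * (6 * ℰ) ∧
          (θ s x - θ₁ s x) ^ 2 ≤ KS * mB⁻¹ * (6 * ℰ) ∧
          ∀ l : Fin 3, (Torus.partialDeriv l (fun y => ρ s y - ρ₁ s y) x) ^ 2 ≤ KS * mA⁻¹ * (6 * ℰ) ∧
            ‖Torus.partialDeriv l (fun y => u s y - u₁ s y) x‖ ^ 2 ≤ KS * mρ⁻¹ * (6 * ℰ) ∧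
            (Torus.partialDeriv l (fun y => θ s y - θ₁ s y) x) ^ 2 ≤ KS * mB⁻¹ * (6 * ℰ)) →
      0 < KT →
      (∀ {s L U ℰ : ℝ}, s ∈ Ico 0 T' → 0 < L → L ≤ 1 → 1 ≤ U → s < T₁ →
        (∀ x, L ≤ ρ₁ s x ^ (1 / 3 : ℝ) ∧ ρ₁ s x ^ (1 / 3 : ℝ) ≤ U) →
        (∀ x, |ρ s x - ρ₁ s x| ≤ ρ₁ s x / 2 ∧ |θ s x - θ₁ s x| ≤ θ₁ s x / 2 ∧ ρ s x * σ ^ 3 ≤ ηs) →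
        shadowE0 ζ ρ θ u ρ₁ θ₁ u₁ s ≤ ℰ → shadowE1 ζ ρ θ u ρ₁ θ₁ u₁ s ≤ ℰ →
        shadowE2 ζ ρ θ u ρ₁ θ₁ u₁ s ≤ ℰ → shadowE3 ζ ρ θ u ρ₁ θ₁ u₁ s ≤ ℰ →
        KT * (4 * U / K) * (6 * ℰ) ≤ (L ^ 3 / 4) ^ 2 → KT * (2 * K / L) * (6 * ℰ) ≤ (K * L ^ 2 / 4) ^ 2 →
        3 / 2 * U ^ 3 * σ ^ 3 ≤ ηs / 2 → KT * (2 / L ^ 3) * (6 * ℰ) ≤ 1 →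
        KT * (2 / L ^ 3) * (6 * ℰ) ≤ (1 / (2 * T₁)) ^ 2 →
        K / L ^ 4 * (KT * (4 * U / K) * (6 * ℰ)) ≤ (1 / (2 * T₁)) ^ 2 →
        1 / (K * L ^ 2) * (KT * (2 * K / L) * (6 * ℰ)) ≤ (1 / (2 * T₁)) ^ 2 →
        ∀ x, |ρ s x - ρ₁ s x| ≤ ρ₁ s x / 4 ∧ |θ s x - θ₁ s x| ≤ θ₁ s x / 4 ∧
          ρ s x * σ ^ 3 ≤ ηs / 2 ∧ ‖u s x - u₁ s x‖ ≤ 1 ∧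
          ∀ i : Fin 3,
            ‖Torus.partialDeriv i (u s) x - Torus.partialDeriv i (u₁ s) x‖ ≤ 1 / (2 * (T₁ - s)) ∧
            Real.sqrt (θ₁ s x) * |Torus.partialDeriv i (ρ s) x - Torus.partialDeriv i (ρ₁ s) x| /
                ρ₁ s x ≤ 1 / (2 * (T₁ - s)) ∧
            |Torus.partialDeriv i (θ s) x - Torus.partialDeriv i (θ₁ s) x| / Real.sqrt (θ₁ s x) ≤
              1 / (2 * (T₁ - s))) →
      (∀ s ∈ Ico 0 T', σ ^ 3 * (QS + 1) * (T₁ / (T₁ - s)) ^ N ≤ 1 ∧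
        (let Y := (T₁ / (T₁ - s)) ^ qs
         KT * (4 * (R * Y) / K) * (6 * (σ ^ 3 * Qh * Y) ^ 2) ≤ ((r / Y) ^ 3 / 4) ^ 2 ∧
         KT * (2 * K / (r / Y)) * (6 * (σ ^ 3 * Qh * Y) ^ 2) ≤ (K * (r / Y) ^ 2 / 4) ^ 2 ∧
         3 / 2 * (R * Y) ^ 3 * σ ^ 3 ≤ ηs / 2 ∧
         KT * (2 / (r / Y) ^ 3) * (6 * (σ ^ 3 * Qh * Y) ^ 2) ≤ 1 ∧
         KT * (2 / (r / Y) ^ 3) * (6 * (σ ^ 3 * Qh * Y) ^ 2) ≤ (1 / (2 * T₁)) ^ 2 ∧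
         K / (r / Y) ^ 4 * (KT * (4 * (R * Y) / K) * (6 * (σ ^ 3 * Qh * Y) ^ 2)) ≤ (1 / (2 * T₁)) ^ 2 ∧
         1 / (K * (r / Y) ^ 2) * (KT * (2 * K / (r / Y)) * (6 * (σ ^ 3 * Qh * Y) ^ 2)) ≤ (1 / (2 * T₁)) ^ 2)) →
      (∀ t₀ ∈ Ico 0 T', ShadowWeakBootstrap 1 (1 / (8 * (cZ + 1))) T₁ σ ρ θ u ρ₁ θ₁ u₁ t₀ →
        ShadowLevelBound (shadowE0 ζ ρ θ u ρ₁ θ₁ u₁) Q₀ b₀ T₁ σ t₀) →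
      (∀ t₀ ∈ Ico 0 T', ShadowWeakBootstrap 1 (1 / (8 * (cZ + 1))) T₁ σ ρ θ u ρ₁ θ₁ u₁ t₀ →
        ShadowLevelBound (shadowE0 ζ ρ θ u ρ₁ θ₁ u₁) (2 * Q₂) b₂ T₁ σ t₀ →
        ShadowLevelBound (shadowE1 ζ ρ θ u ρ₁ θ₁ u₁) (2 * Q₂) b₂ T₁ σ t₀ →
        ShadowLevelBound (shadowE2 ζ ρ θ u ρ₁ θ₁ u₁) (2 * Q₂) b₂ T₁ σ t₀ →
        (∀ s ∈ Icc 0 t₀, ∀ x, l3m0 ρ θ ρ₁ θ₁ u u₁ s x ≤ σ ^ 3 * QS * (T₁ / (T₁ - s)) ^ bS ∧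
          l3m1 ρ θ ρ₁ θ₁ u u₁ s x ≤ σ ^ 3 * QS * (T₁ / (T₁ - s)) ^ bS) →
        (∀ s ∈ Icc 0 t₀, σ ^ 3 * (QS + 1) * (T₁ / (T₁ - s)) ^ N ≤ 1) →
        ShadowLevelBound (shadowE3 ζ ρ θ u ρ₁ θ₁ u₁) Q₃ b₃ T₁ σ t₀) →
      (∀ s ∈ Ico 0 T', ∀ m M : ℝ, 0 < m →
        (∀ x, m ≤ shadowWeightA ζ ρ θ s x ∧ shadowWeightA ζ ρ θ s x ≤ M ∧ m ≤ ρ s x ∧ ρ s x ≤ M ∧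
          m ≤ shadowWeightB ρ θ s x ∧ shadowWeightB ρ θ s x ≤ M) →
        shadowE1 ζ ρ θ u ρ₁ θ₁ u₁ s ≤ Real.sqrt 3 * (M / m) * Real.sqrt (shadowE0 ζ ρ θ u ρ₁ θ₁ u₁ s) *
            Real.sqrt (shadowE2 ζ ρ θ u ρ₁ θ₁ u₁ s) ∧
          shadowE2 ζ ρ θ u ρ₁ θ₁ u₁ s ≤ Real.sqrt 3 * (M / m) * Real.sqrt (shadowE1 ζ ρ θ u ρ₁ θ₁ u₁ s) *
            Real.sqrt (shadowE3 ζ ρ θ u ρ₁ θ₁ u₁ s)) →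
      ShadowWeakBootstrap 1 ηs T₁ σ ρ θ u ρ₁ θ₁ u₁ t →
      (∀ s ∈ Icc 0 t, Real.sqrt (shadowE1 ζ ρ θ u ρ₁ θ₁ u₁ s) ≤ 2 * (σ ^ 3 * Q₁ * (T₁ / (T₁ - s)) ^ b₁) ∧
        Real.sqrt (shadowE2 ζ ρ θ u ρ₁ θ₁ u₁ s) ≤ 2 * (σ ^ 3 * Q₂ * (T₁ / (T₁ - s)) ^ b₂) ∧
        Real.sqrt (shadowE3 ζ ρ θ u ρ₁ θ₁ u₁ s) ≤ 2 * (σ ^ 3 * Q₃ * (T₁ / (T₁ - s)) ^ b₃)) →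
      (∀ x, |ρ t x - ρ₁ t x| ≤ ρ₁ t x / 4 ∧ |θ t x - θ₁ t x| ≤ θ₁ t x / 4 ∧
          ρ t x * σ ^ 3 ≤ ηs / 2 ∧ ‖u t x - u₁ t x‖ ≤ 1 ∧
          ∀ i : Fin 3,
            ‖Torus.partialDeriv i (u t) x - Torus.partialDeriv i (u₁ t) x‖ ≤ 1 / (2 * (T₁ - t)) ∧
            Real.sqrt (θ₁ t x) * |Torus.partialDeriv i (ρ t) x - Torus.partialDeriv i (ρ₁ t) x| /
                ρ₁ t x ≤ 1 / (2 * (T₁ - t)) ∧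
            |Torus.partialDeriv i (θ t) x - Torus.partialDeriv i (θ₁ t) x| / Real.sqrt (θ₁ t x) ≤
              1 / (2 * (T₁ - t))) ∧
        Real.sqrt (shadowE1 ζ ρ θ u ρ₁ θ₁ u₁ t) ≤ σ ^ 3 * Q₁ * (T₁ / (T₁ - t)) ^ b₁ ∧
        Real.sqrt (shadowE2 ζ ρ θ u ρ₁ θ₁ u₁ t) ≤ σ ^ 3 * Q₂ * (T₁ / (T₁ - t)) ^ b₂ ∧
        Real.sqrt (shadowE3 ζ ρ θ u ρ₁ θ₁ u₁ t) ≤ σ ^ 3 * Q₃ * (T₁ / (T₁ - t)) ^ b₃ := by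
  intro K C cZ T₁ cl pl σ T' t ηs r R qe qs Q₀ b₀ Q₁ b₁ Q₂ b₂ Q₃ b₃ W₀ pw Qh QS bS N KS KT Cpoly ppoly Cstat
    ρ θ ρ₁ θ₁ u u₁ ζ J hS hK hcZ ht hηs hηs8 hcZηs hr hr1 hR hqe hqes henv hQ₀ hQ01 hQ12 hQ₃ hb₀ hb01 hb12 hb23
    hb3qs hW₀ hpw hI12 hI23 hbI1 hbI2 hQh hW₀def hKS hQS hbS hSup hKT hStep hwin hL0 hL3 hI hweak hweakE
  have hqs : 0 ≤ qs := hqe.trans hqes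
  obtain ⟨hE, hE₁, hσ, -, -, hTT₁, -, -, -, -, hEos, hIsen, -, -, -, -, -, -⟩ := hS
  have hts : ∀ s ∈ Icc 0 t, s ∈ Ico 0 T' := fun s hs => ⟨hs.1, hs.2.trans_lt ht.2⟩
  have hX1 : ∀ s ∈ Icc 0 t, 1 ≤ T₁ / (T₁ - s) := fun s hs => (henv s (hts s hs)).1
  have hσ3 : 0 ≤ σ ^ 3 := by positivity
  have hQ₁ : 0 ≤ Q₁ := hQ₀.trans hQ01
  have hQ₂ : 0 ≤ Q₂ := hQ₁.trans hQ12
  -- (a) WEAK gives the weak regime with the packing threshold `1/(8(cZ+1))`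
  have hweak' : ShadowWeakBootstrap 1 (1 / (8 * (cZ + 1))) T₁ σ ρ θ u ρ₁ θ₁ u₁ t :=
    ⟨fun s hs x => ⟨(hweak.1 s hs x).1, (hweak.1 s hs x).2.1, (hweak.1 s hs x).2.2.trans hηs8⟩, hweak.2⟩
  -- (b)-(c) the level bounds on `[0, t]`: `E₀` from `L0`, `E₁, E₂, E₃` from WEAK
  have hE0 : ShadowLevelBound (shadowE0 ζ ρ θ u ρ₁ θ₁ u₁) Q₀ b₀ T₁ σ t := hL0 t ht hweak'
  have hE1w : ShadowLevelBound (shadowE1 ζ ρ θ u ρ₁ θ₁ u₁) (2 * Q₁) b₁ T₁ σ t := fun s hs => by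
    have h := (hweakE s hs).1; linarith
  have hE2w : ShadowLevelBound (shadowE2 ζ ρ θ u ρ₁ θ₁ u₁) (2 * Q₂) b₂ T₁ σ t := fun s hs => by
    have h := (hweakE s hs).2.1; linarith
  have hE3w : ShadowLevelBound (shadowE3 ζ ρ θ u ρ₁ θ₁ u₁) (2 * Q₃) b₃ T₁ σ t := fun s hs => by
    have h := (hweakE s hs).2.2; linarith
  have hE0' : ShadowLevelBound (shadowE0 ζ ρ θ u ρ₁ θ₁ u₁) (2 * Q₂) b₂ T₁ σ t :=
    shadowLevelBound_mono_exp hE0 hQ₀ (by linarith) (by linarith) hσ.le hX1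
  have hE1' : ShadowLevelBound (shadowE1 ζ ρ θ u ρ₁ θ₁ u₁) (2 * Q₂) b₂ T₁ σ t :=
    shadowLevelBound_mono_exp hE1w (by linarith) (by linarith) hb12 hσ.le hX1
  -- energies at a time `s ≤ t` against the common envelope `ℰ = (σ³ Qh Y)²`, `Y = X^qs`
  have hlev : ∀ s ∈ Icc 0 t,
      shadowE0 ζ ρ θ u ρ₁ θ₁ u₁ s ≤ (σ ^ 3 * Qh * ((T₁ / (T₁ - s)) ^ qs)) ^ 2 ∧
      shadowE1 ζ ρ θ u ρ₁ θ₁ u₁ s ≤ (σ ^ 3 * Qh * ((T₁ / (T₁ - s)) ^ qs)) ^ 2 ∧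
      shadowE2 ζ ρ θ u ρ₁ θ₁ u₁ s ≤ (σ ^ 3 * Qh * ((T₁ / (T₁ - s)) ^ qs)) ^ 2 ∧
      shadowE3 ζ ρ θ u ρ₁ θ₁ u₁ s ≤ (σ ^ 3 * Qh * ((T₁ / (T₁ - s)) ^ qs)) ^ 2 := by
    intro s hs
    have hXq : 1 ≤ (T₁ / (T₁ - s)) ^ qs := Real.one_le_rpow (hX1 s hs) hqs
    have h := lbClose_levels_at (Qh := Qh) (q := qs) (QB := 2 * Q₂ + 2 * Q₃) (bB := qs) hE0 hE1w hE2w hE3w hs hσ.le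
      (hX1 s hs) hQ₀ (by linarith) (by linarith) (by linarith) (by linarith) (by linarith)
      (by linarith) (by linarith) (by linarith) (by linarith) (by linarith) (by linarith)
    -- `(σ³ Qh X^qs)² = (σ³ Qh Y)²` with `Y = X^qs`; `levels_at` is stated with base `X` and exponent `q`
    exact ⟨h.1, h.2.1, h.2.2.1, h.2.2.2.1⟩
  -- point facts at a time `s ≤ t`: reference scale, weights in `[m_s, M_s]`
  have hpt : ∀ q : ℝ, qe ≤ q → ∀ s ∈ Icc 0 t, ∀ x,
      0 < ρ₁ s x ∧ 1 ≤ ((T₁ / (T₁ - s)) ^ q) ∧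
      min (K / (4 * (R * ((T₁ / (T₁ - s)) ^ q)))) (min ((r / ((T₁ / (T₁ - s)) ^ q)) ^ 3 / 2) ((r / ((T₁ / (T₁ - s)) ^ q)) / (2 * K))) ≤ shadowWeightA ζ ρ θ s x ∧
      shadowWeightA ζ ρ θ s x ≤ max (4 * K / (r / ((T₁ / (T₁ - s)) ^ q))) (max (3 / 2 * (R * ((T₁ / (T₁ - s)) ^ q)) ^ 3) (9 / 2 * (R * ((T₁ / (T₁ - s)) ^ q)) / K)) ∧
      min (K / (4 * (R * ((T₁ / (T₁ - s)) ^ q)))) (min ((r / ((T₁ / (T₁ - s)) ^ q)) ^ 3 / 2) ((r / ((T₁ / (T₁ - s)) ^ q)) / (2 * K))) ≤ ρ s x ∧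
      ρ s x ≤ max (4 * K / (r / ((T₁ / (T₁ - s)) ^ q))) (max (3 / 2 * (R * ((T₁ / (T₁ - s)) ^ q)) ^ 3) (9 / 2 * (R * ((T₁ / (T₁ - s)) ^ q)) / K)) ∧
      min (K / (4 * (R * ((T₁ / (T₁ - s)) ^ q)))) (min ((r / ((T₁ / (T₁ - s)) ^ q)) ^ 3 / 2) ((r / ((T₁ / (T₁ - s)) ^ q)) / (2 * K))) ≤ shadowWeightB ρ θ s x ∧
      shadowWeightB ρ θ s x ≤ max (4 * K / (r / ((T₁ / (T₁ - s)) ^ q))) (max (3 / 2 * (R * ((T₁ / (T₁ - s)) ^ q)) ^ 3) (9 / 2 * (R * ((T₁ / (T₁ - s)) ^ q)) / K)) ∧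
      r / ((T₁ / (T₁ - s)) ^ q) ≤ ρ₁ s x ^ (1 / 3 : ℝ) ∧ ρ₁ s x ^ (1 / 3 : ℝ) ≤ R * ((T₁ / (T₁ - s)) ^ q) := by
    intro q hq s hs x
    have hsT := hts s hs
    obtain ⟨hXs, henvq⟩ := henv s hsT
    have hY : 1 ≤ (T₁ / (T₁ - s)) ^ q := Real.one_le_rpow hXs (hqe.trans hq)
    have hmono : (T₁ / (T₁ - s)) ^ qe ≤ (T₁ / (T₁ - s)) ^ q := Real.rpow_le_rpow_of_exponent_le hXs hq
    have hqe0 : 0 < (T₁ / (T₁ - s)) ^ qe := Real.rpow_pos_of_pos (by linarith) qe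
    have henvx : ∀ y, r / (T₁ / (T₁ - s)) ^ q ≤ ρ₁ s y ^ (1 / 3 : ℝ) ∧
        ρ₁ s y ^ (1 / 3 : ℝ) ≤ R * (T₁ / (T₁ - s)) ^ q := fun y =>
      ⟨(div_le_div_of_nonneg_left hr.le hqe0 hmono).trans (henvq y).1,
        (henvq y).2.trans (mul_le_mul_of_nonneg_left hmono (by linarith))⟩
    generalize hYdef : (T₁ / (T₁ - s)) ^ q = Y at hY henvx ⊢
    have hρ₁ := hE₁.density_pos s hsT x
    obtain ⟨hc₁, hρ₁c, hθ₁c, -⟩ := isentropic_pointwise_algebra hK hρ₁ (hIsen s hsT x)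
    obtain ⟨hLc, hcU⟩ := henvx x
    obtain ⟨hw1, hw2, hw3⟩ := hweak.1 s hs x
    obtain ⟨he1, he2, -⟩ := hEos s hsT x
    have hρ := hE.density_pos s hsT x
    have hpk : cZ * (ρ s x * σ ^ 3) ≤ 1 / 8 := (mul_le_mul_of_nonneg_left hw3 hcZ).trans hcZηs
    have hz1 : |ζ (ρ s x) - 1| ≤ 1 / 8 := he1.trans hpk
    have hz2 : |ρ s x * deriv ζ (ρ s x)| ≤ 1 / 8 := he2.trans hpk
    have hL : 0 < r / Y := by positivity
    rw [hρ₁c] at hw1; rw [hθ₁c] at hw2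
    obtain ⟨p1, p2, p3, p4, p5⟩ := lbClose_point_facts hK hL hLc hcU rfl rfl hw1 hw2 hz1 hz2
    -- the temperature weight from above: `B = (3/2)ρ/θ ≤ (9/2) c₁/K ≤ (9/2) U/K`
    have hθlow : K * (ρ₁ s x ^ (1 / 3 : ℝ)) ^ 2 / 2 ≤ θ s x := by linarith [(abs_le.1 hw2).1]
    have hθpos : 0 < θ s x := lt_of_lt_of_le (by positivity) hθlow
    have hBup : shadowWeightB ρ θ s x ≤ 9 / 2 * (R * Y) / K := by
      have hKne : K ≠ 0 := hK.ne'
      set c : ℝ := ρ₁ s x ^ (1 / 3 : ℝ) with hcdef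
      have h1 : ρ s x ≤ 3 / 2 * c ^ 3 := by linarith [(abs_le.1 hw1).2]
      have h2 : c ^ 3 ≤ c ^ 2 * (R * Y) := by
        calc c ^ 3 = c ^ 2 * c := by ring
          _ ≤ c ^ 2 * (R * Y) := mul_le_mul_of_nonneg_left hcU (sq_nonneg _)
      have h3 : 9 / 2 * (R * Y) / K * (K * c ^ 2 / 2) ≤ 9 / 2 * (R * Y) / K * θ s x :=
        mul_le_mul_of_nonneg_left hθlow (by positivity)
      have h4 : 9 / 2 * (R * Y) / K * (K * c ^ 2 / 2) = 9 / 4 * (c ^ 2 * (R * Y)) := by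
        field_simp
        ring
      change 3 / 2 * ρ s x / θ s x ≤ 9 / 2 * (R * Y) / K
      rw [div_le_iff₀ hθpos]
      calc 3 / 2 * ρ s x ≤ 3 / 2 * (3 / 2 * c ^ 3) := by linarith
        _ ≤ 3 / 2 * (3 / 2 * (c ^ 2 * (R * Y))) := by linarith
        _ = 9 / 2 * (R * Y) / K * (K * c ^ 2 / 2) := by rw [h4]; ring
        _ ≤ 9 / 2 * (R * Y) / K * θ s x := h3
    have hA : shadowWeightA ζ ρ θ s x = θ s x * (ζ (ρ s x) + ρ s x * deriv ζ (ρ s x)) / ρ s x := rfl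
    have hB : shadowWeightB ρ θ s x = 3 / 2 * ρ s x / θ s x := rfl
    refine ⟨hρ₁, hY, ?_, ?_, ?_, ?_, ?_, ?_, hLc, hcU⟩
    · rw [hA]; exact (min_le_left _ _).trans p3
    · rw [hA]; exact p4.trans (le_max_left _ _)
    · exact ((min_le_right _ _).trans (min_le_left _ _)).trans p1
    · exact p2.trans ((le_max_left _ _).trans (le_max_right _ _))
    · rw [hB]; exact ((min_le_right _ _).trans (min_le_right _ _)).trans p5
    · exact hBup.trans ((le_max_right _ _).trans (le_max_right _ _))
  -- the floor and the ratio against `mK`, `W₀`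
  set mK : ℝ := min (K / (4 * R)) (min (r ^ 3 / 2) (r / (2 * K))) with hmKdef
  have hmK : 0 < mK := lt_min (by positivity) (lt_min (by positivity) (by positivity))
  have hfloor : ∀ {Y : ℝ}, 1 ≤ Y →
      mK / Y ^ 3 ≤ min (K / (4 * (R * Y))) (min ((r / Y) ^ 3 / 2) ((r / Y) / (2 * K))) ∧
      max (4 * K / (r / Y)) (max (3 / 2 * (R * Y) ^ 3) (9 / 2 * (R * Y) / K)) ≤
        max (4 * K / r) (max (3 / 2 * R ^ 3) (9 / 2 * R / K)) * Y ^ 3 := by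
    intro Y hY
    have hY0 : 0 < Y := by linarith
    have hY3 : 1 ≤ Y ^ 3 := one_le_pow₀ hY
    have hY13 : Y ≤ Y ^ 3 := le_self_pow₀ hY (by norm_num)
    constructor
    · refine le_min ?_ (le_min ?_ ?_)
      · calc mK / Y ^ 3 ≤ (K / (4 * R)) / Y ^ 3 := div_le_div_of_nonneg_right (min_le_left _ _) (by positivity)
          _ ≤ (K / (4 * R)) / Y := div_le_div_of_nonneg_left (by positivity) hY0 hY13
          _ = K / (4 * (R * Y)) := by field_simp
      · calc mK / Y ^ 3 ≤ (r ^ 3 / 2) / Y ^ 3 :=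
            div_le_div_of_nonneg_right ((min_le_right _ _).trans (min_le_left _ _)) (by positivity)
          _ = (r / Y) ^ 3 / 2 := by field_simp
      · calc mK / Y ^ 3 ≤ (r / (2 * K)) / Y ^ 3 :=
            div_le_div_of_nonneg_right ((min_le_right _ _).trans (min_le_right _ _)) (by positivity)
          _ ≤ (r / (2 * K)) / Y := div_le_div_of_nonneg_left (by positivity) hY0 hY13
          _ = (r / Y) / (2 * K) := by field_simp
    · set MK : ℝ := max (4 * K / r) (max (3 / 2 * R ^ 3) (9 / 2 * R / K)) with hMKdef
      have hMK : 0 ≤ MK := le_trans (by positivity) (le_max_left _ _)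
      refine max_le ?_ (max_le ?_ ?_)
      · calc 4 * K / (r / Y) = (4 * K / r) * Y := by field_simp
          _ ≤ MK * Y := mul_le_mul_of_nonneg_right (le_max_left _ _) hY0.le
          _ ≤ MK * Y ^ 3 := mul_le_mul_of_nonneg_left hY13 hMK
      · calc 3 / 2 * (R * Y) ^ 3 = (3 / 2 * R ^ 3) * Y ^ 3 := by ring
          _ ≤ MK * Y ^ 3 := mul_le_mul_of_nonneg_right ((le_max_left _ _).trans (le_max_right _ _)) (by positivity)
      · calc 9 / 2 * (R * Y) / K = (9 / 2 * R / K) * Y := by field_simp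
          _ ≤ MK * Y := mul_le_mul_of_nonneg_right ((le_max_right _ _).trans (le_max_right _ _)) hY0.le
          _ ≤ MK * Y ^ 3 := mul_le_mul_of_nonneg_left hY13 hMK
  -- (d) the sup smallness on `[0, t]`
  have hsmall : ∀ s ∈ Icc 0 t, ∀ x, l3m0 ρ θ ρ₁ θ₁ u u₁ s x ≤ σ ^ 3 * QS * (T₁ / (T₁ - s)) ^ bS ∧
      l3m1 ρ θ ρ₁ θ₁ u u₁ s x ≤ σ ^ 3 * QS * (T₁ / (T₁ - s)) ^ bS := by
    intro s hs x
    have hsT := hts s hs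
    have hX := hX1 s hs
    have hp := hpt qs hqes s hs
    have hY : 1 ≤ (T₁ / (T₁ - s)) ^ qs := (hp x).2.1
    have hYb : ((T₁ / (T₁ - s)) ^ qs) ^ 3 ≤ (T₁ / (T₁ - s)) ^ bS := by
      rw [← Real.rpow_natCast, ← Real.rpow_mul (by linarith)]
      exact Real.rpow_le_rpow_of_exponent_le hX (by push_cast; linarith)
    obtain ⟨l0, l1, l2, l3⟩ := hlev s hs
    generalize hXdef : T₁ / (T₁ - s) = X at hX hYb hp hY l0 l1 l2 l3
    generalize hYdef : X ^ qs = Y at hp hY hYb l0 l1 l2 l3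
    have hY0 : 0 < Y := by linarith
    have hm : 0 < min (K / (4 * (R * Y))) (min ((r / Y) ^ 3 / 2) ((r / Y) / (2 * K))) :=
      lt_min (by positivity) (lt_min (by positivity) (by positivity))
    generalize hmdef : min (K / (4 * (R * Y))) (min ((r / Y) ^ 3 / 2) ((r / Y) / (2 * K))) = m at hm hp
    have hmfl : mK / Y ^ 3 ≤ m := by rw [← hmdef]; exact (hfloor hY).1
    generalize hℰdef : (σ ^ 3 * Qh * Y) ^ 2 = ℰ at l0 l1 l2 l3
    have hℰ0 : 0 ≤ ℰ := by rw [← hℰdef]; positivity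
    have hsupx := hSup hsT hm hm hm (fun y => (hp y).2.2.1) (fun y => (hp y).2.2.2.2.1)
      (fun y => (hp y).2.2.2.2.2.2.1) l0 l1 l2 l3 x
    have hsm : Torus.IsSmooth (fun y => u s y - u₁ s y) :=
      (hE.smooth_velocity.isSmooth_slice hsT).sub (hE₁.smooth_velocity.isSmooth_slice hsT)
    have hQh0 : 0 ≤ Qh := by linarith
    obtain ⟨b0, b1⟩ := pcClose_sup_small hsm hm le_rfl le_rfl le_rfl hKS.le hℰ0 hsupx
    -- `√(KS m⁻¹ 6ℰ) ≤ √(KS mK⁻¹ 6) · σ³ Qh · Y³ ≤ (QS/15) σ³ X^{bS}`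
    have hmY : m⁻¹ ≤ mK⁻¹ * Y ^ 4 := by
      have h1 : mK / Y ^ 3 ≤ m := hmfl
      have h2 : m⁻¹ ≤ (mK / Y ^ 3)⁻¹ := (inv_le_inv₀ hm (by positivity)).2 h1
      have h3 : (mK / Y ^ 3)⁻¹ = mK⁻¹ * Y ^ 3 := by rw [inv_div]; field_simp
      have h4 : Y ^ 3 ≤ Y ^ 4 := pow_le_pow_right₀ hY (by norm_num)
      calc m⁻¹ ≤ mK⁻¹ * Y ^ 3 := h2.trans_eq h3
        _ ≤ mK⁻¹ * Y ^ 4 := mul_le_mul_of_nonneg_left h4 (by positivity)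
    have hG : Real.sqrt (KS * m⁻¹ * (6 * ℰ)) ≤ Real.sqrt (KS * mK⁻¹ * 6) * (σ ^ 3 * Qh * Y ^ 3) := by
      have h1 : KS * m⁻¹ * (6 * ℰ) ≤ (Real.sqrt (KS * mK⁻¹ * 6) * (σ ^ 3 * Qh * Y ^ 3)) ^ 2 := by
        calc KS * m⁻¹ * (6 * ℰ) = (KS * 6 * (σ ^ 3 * Qh * Y) ^ 2) * m⁻¹ := by rw [← hℰdef]; ring
          _ ≤ (KS * 6 * (σ ^ 3 * Qh * Y) ^ 2) * (mK⁻¹ * Y ^ 4) := mul_le_mul_of_nonneg_left hmY (by positivity)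
          _ = (Real.sqrt (KS * mK⁻¹ * 6) * (σ ^ 3 * Qh * Y ^ 3)) ^ 2 := by
              have hsq : Real.sqrt (KS * mK⁻¹ * 6) ^ 2 = KS * mK⁻¹ * 6 := Real.sq_sqrt (by positivity)
              have e : (Real.sqrt (KS * mK⁻¹ * 6) * (σ ^ 3 * Qh * Y ^ 3)) ^ 2 =
                  (KS * mK⁻¹ * 6) * (σ ^ 3 * Qh * Y ^ 3) ^ 2 := by rw [mul_pow, hsq]
              rw [e]; ring
      exact Real.sqrt_le_iff.2 ⟨by positivity, h1⟩
    have hfin : 15 * Real.sqrt (KS * m⁻¹ * (6 * ℰ)) ≤ σ ^ 3 * QS * X ^ bS := by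
      calc 15 * Real.sqrt (KS * m⁻¹ * (6 * ℰ)) ≤ 15 * (Real.sqrt (KS * mK⁻¹ * 6) * (σ ^ 3 * Qh * Y ^ 3)) := by
            linarith only [hG]
        _ = (15 * Real.sqrt (KS * mK⁻¹ * 6) * Qh) * (σ ^ 3 * Y ^ 3) := by ring
        _ ≤ QS * (σ ^ 3 * X ^ bS) := mul_le_mul hQS (mul_le_mul_of_nonneg_left hYb hσ3) (by positivity)
            ((by positivity : (0:ℝ) ≤ 15 * Real.sqrt (KS * mK⁻¹ * 6) * Qh).trans hQS)
        _ = σ ^ 3 * QS * X ^ bS := by ring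
    have hG0 : 0 ≤ Real.sqrt (KS * m⁻¹ * (6 * ℰ)) := Real.sqrt_nonneg _
    exact ⟨b0.trans (le_trans (by linarith only [hG0]) hfin), b1.trans hfin⟩
  -- (e) the level-3 contract on `[0, t]`
  have hE3 : ShadowLevelBound (shadowE3 ζ ρ θ u ρ₁ θ₁ u₁) Q₃ b₃ T₁ σ t :=
    hL3 t ht hweak' hE0' hE1' hE2w hsmall (fun s hs => (hwin s (hts s hs)).1)
  have htt : t ∈ Icc 0 t := ⟨ht.1, le_rfl⟩
  have sE3 : Real.sqrt (shadowE3 ζ ρ θ u ρ₁ θ₁ u₁ t) ≤ σ ^ 3 * Q₃ * (T₁ / (T₁ - t)) ^ b₃ := hE3 t htt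
  -- (f) the interpolation closure at `t`: weights in `[m, M]` on the scale `Ye = X(t)^qe`
  have hX := hX1 t htt
  have hX0 : 0 < T₁ / (T₁ - t) := lt_of_lt_of_le one_pos hX
  have hpe := hpt qe le_rfl t htt
  have hYe : 1 ≤ (T₁ / (T₁ - t)) ^ qe := (hpe (Classical.arbitrary T3)).2.1
  have hm : 0 < min (K / (4 * (R * (T₁ / (T₁ - t)) ^ qe)))
      (min ((r / (T₁ / (T₁ - t)) ^ qe) ^ 3 / 2) ((r / (T₁ / (T₁ - t)) ^ qe) / (2 * K))) := by
    have hYe0 : 0 < (T₁ / (T₁ - t)) ^ qe := lt_of_lt_of_le one_pos hYe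
    exact lt_min (by positivity) (lt_min (by positivity) (by positivity))
  have hMK0 : 0 ≤ max (4 * K / r) (max (3 / 2 * R ^ 3) (9 / 2 * R / K)) :=
    le_trans (by positivity) (le_max_left _ _)
  have hpw6 : ((6 : ℕ) : ℝ) * qe ≤ pw := by push_cast; linarith only [hpw]
  have hY6 : ((T₁ / (T₁ - t)) ^ qe) ^ 6 ≤ (T₁ / (T₁ - t)) ^ pw := by
    rw [← Real.rpow_natCast, ← Real.rpow_mul hX0.le]
    exact Real.rpow_le_rpow_of_exponent_le hX (by rw [mul_comm]; exact hpw6)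
  obtain ⟨hmfl, hMce⟩ := hfloor hYe
  have hMpos : 0 ≤ max (4 * K / (r / (T₁ / (T₁ - t)) ^ qe))
      (max (3 / 2 * (R * (T₁ / (T₁ - t)) ^ qe) ^ 3) (9 / 2 * (R * (T₁ / (T₁ - t)) ^ qe) / K)) :=
    hm.le.trans (((hpe (Classical.arbitrary T3)).2.2.1).trans (hpe (Classical.arbitrary T3)).2.2.2.1)
  have hratio := pcClose_ratio_real hmK hYe hMK0 hmfl hMce hW₀def hW₀ hY6
  obtain ⟨iE1, iE2⟩ := hI t ht _ _ hm fun y =>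
    ⟨(hpe y).2.2.1, (hpe y).2.2.2.1, (hpe y).2.2.2.2.1, (hpe y).2.2.2.2.2.1, (hpe y).2.2.2.2.2.2.1,
      (hpe y).2.2.2.2.2.2.2.1⟩
  obtain ⟨sE1, sE2⟩ := pcClose_interp_real hX hσ3 hQ₁ hQ₂ hW₀ (div_nonneg hMpos hm.le) hratio iE1 iE2
    (hE0 t htt) (hweakE t htt).1 sE3 hI12 hI23 hbI1 hbI2
  -- (g) the state and derivative bounds at `t` by `lbClose_step` on the scale `Y = X(t)^qs`
  have hp := hpt qs hqes t htt
  have hY : 1 ≤ (T₁ / (T₁ - t)) ^ qs := (hp (Classical.arbitrary T3)).2.1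
  have hY0 : 0 < (T₁ / (T₁ - t)) ^ qs := lt_of_lt_of_le one_pos hY
  obtain ⟨l0, l1, l2, l3⟩ := hlev t htt
  obtain ⟨-, w1, w2, w3, w4, w5, w6, w7⟩ := hwin t ht
  have hLpos : 0 < r / (T₁ / (T₁ - t)) ^ qs := div_pos hr hY0
  have hL1 : r / (T₁ / (T₁ - t)) ^ qs ≤ 1 := (div_le_one hY0).2 (hr1.trans hY)
  have hU1 : 1 ≤ R * (T₁ / (T₁ - t)) ^ qs := one_le_mul_of_one_le_of_one_le hR hY
  have htT₁ : t < T₁ := lt_of_lt_of_le ht.2 hTT₁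
  have hstate := hStep (s := t) (L := r / (T₁ / (T₁ - t)) ^ qs) (U := R * (T₁ / (T₁ - t)) ^ qs)
    (ℰ := (σ ^ 3 * Qh * (T₁ / (T₁ - t)) ^ qs) ^ 2) ht hLpos hL1 hU1 htT₁
    (fun y => ⟨(hp y).2.2.2.2.2.2.2.2.1, (hp y).2.2.2.2.2.2.2.2.2⟩)
    (hweak.1 t htt) l0 l1 l2 l3 w1 w2 w3 w4 w5 w6 w7
  exact ⟨hstate, sE1, sE2, sE3⟩

end Summit.AtomisticToContinuum.HydrodynamicLimit.Theorems

end
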